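import Literature.AlgebraicGeometry.CossartJannsenSaito2020.KeyTheorems
import Literature.AlgebraicGeometry.Resolution.AlterationsNormalFormStrictTransform
import Mathlib.AlgebraicGeometry.Morphisms.ClosedImmersion
import Mathlib.AlgebraicGeometry.ResidueField
import HarnessLib

/-!
# `π` induces an isomorphism `{x'} ⥲ {x}` of reduced points when `k(x) ⥲ k(x')` (the «(ISO-pt)» brick for CJS Def. 6.34 (iii) /
# Def. 6.38 (iv) with POINT centres; crux chain w42, line `w_ladder` v6, e = 1 bridge `Moving.IsoE1BridgeM`)

OURS plumbing (cell res-hironaka, slot W4.2, LEAD PROVER res-L1-w42-lead-1 gen 3); NOT a statement of [CossartJannsenSaito2020];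
AI proving, weaker than expert review. No named fact. `--supports stmt-ResolutionOfSingularities-19249`.

`inducesIsoOn_singleton_of_isIso_residueFieldMap`: for `π : Y' ⟶ Y`, closed points `x' ∈ Y'`, `x = π x' ∈ Y` with
`IsIso (π.residueFieldMap x')`, the tree's `InducesIsoOn π {x'} {x}` (an isomorphism of the REDUCED one-point closed subschemes
commuting with `π`; `Literature…CossartJannsenSaito2020.InducesIsoOn`, the typing of «`π_q : C_q ⥲ C_{q−1}`» in Def. 6.34 (iii) /
Def. 6.38 (iv)). Proof: the reduced point `𝓘({x}).subscheme` is `Spec k(x)` over `Y` (both are closed immersions with kernel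
`𝓘({x})`: Mathlib `IsClosedImmersion.lift`/`isIso_of_ker_eq`, tree `ker_eq_vanishingIdeal_range`), and
`Spec k(x') ⥲ Spec k(x)` over `π` (Mathlib `Scheme.Hom.SpecMap_residueFieldMap_fromSpecResidueField`).

## References

* V. Cossart, U. Jannsen, S. Saito, LNM 2270 (2020), Def. 6.34 (iii), Def. 6.38 (iv), p. 103 L32. [CossartJannsenSaito2020]
-/

noncomputable section

open CategoryTheory AlgebraicGeometry TopologicalSpace
open Literature.AlgebraicGeometry.Resolution

set_option linter.dupNamespace false -- mandated namespace of this single-conjunct summit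

open Literature.AlgebraicGeometry.CossartJannsenSaito2020

namespace Summit.ResolutionOfSingularities.ResolutionOfSingularities.Theorems.SigmaMaxModificationsCorridor3.Helpers

universe u

/-- **The reduced closed point `𝓘({x}).subscheme` is `Spec k(x)` over `Y`** (for a CLOSED point `x`): an isomorphism
`Spec k(x) ≅ 𝓘({x}).subscheme` commuting with the two closed immersions into `Y` (both have kernel `𝓘({x})`). [folklore] -/
theorem exists_iso_fromSpecResidueField_subscheme {Y : Scheme.{u}} (x : Y) (hx : IsClosed ({x} : Set Y)) :
    ∃ e : Spec (Y.residueField x) ≅ (Scheme.IdealSheafData.vanishingIdeal ⟨{x}, hx⟩).subscheme,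
      e.hom ≫ (Scheme.IdealSheafData.vanishingIdeal ⟨{x}, hx⟩).subschemeι = Y.fromSpecResidueField x := by
  haveI : IsClosedImmersion (Y.fromSpecResidueField x) := isClosed_singleton_iff_isClosedImmersion.mp hx
  haveI : IsReduced (Spec (Y.residueField x)) := inferInstance
  have hker : (Y.fromSpecResidueField x).ker = Scheme.IdealSheafData.vanishingIdeal ⟨{x}, hx⟩ := by
    have hrange : Set.range (Y.fromSpecResidueField x).base = {x} := Scheme.range_fromSpecResidueField x
    have hcl : IsClosed (Set.range (Y.fromSpecResidueField x).base) := by rw [hrange]; exact hx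
    rw [ker_eq_vanishingIdeal_range (Y.fromSpecResidueField x) hcl]
    congr 1
    exact Closeds.ext hrange
  have hker' : (Y.fromSpecResidueField x).ker = (Scheme.IdealSheafData.vanishingIdeal ⟨{x}, hx⟩).subschemeι.ker := by
    rw [hker, Scheme.IdealSheafData.ker_subschemeι]
  let f := IsClosedImmersion.lift (Scheme.IdealSheafData.vanishingIdeal ⟨{x}, hx⟩).subschemeι
    (Y.fromSpecResidueField x) hker'.symm.le
  haveI : IsIso f := IsClosedImmersion.isIso_lift _ _ hker'.symm
  exact ⟨asIso f, IsClosedImmersion.lift_fac _ _ _⟩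

/-- **«`π` induces an isomorphism `{x'} ⥲ {x}`» for closed points with trivial residue extension** (`InducesIsoOn π {x'} {x}`
from `IsIso (π.residueFieldMap x')`): the typed clause (iii) of CJS Def. 6.34 / (iv) of Def. 6.38 for POINT centres, e.g. along
the fundamental sequence over a point with `e = 1` (p. 103 L32 «if `e^O_x(X) ≤ 1` then `k(y) = k(x)`»).
[cite: CossartJannsenSaito2020, Def. 6.34 (iii), Def. 6.38 (iv), p. 103] -/
theorem inducesIsoOn_singleton_of_isIso_residueFieldMap {Y' Y : Scheme.{u}} (π : Y' ⟶ Y) {x' : Y'} {x : Y}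
    (hx' : IsClosed ({x'} : Set Y')) (hx : IsClosed ({x} : Set Y)) (hπ : π.base x' = x)
    [IsIso (π.residueFieldMap x')] : InducesIsoOn π {x'} hx' {x} hx := by
  subst hπ
  obtain ⟨e', he'⟩ := exists_iso_fromSpecResidueField_subscheme x' hx'
  obtain ⟨e, he⟩ := exists_iso_fromSpecResidueField_subscheme (π.base x') hx
  let r : Spec (Y'.residueField x') ≅ Spec (Y.residueField (π.base x')) := asIso (Spec.map (π.residueFieldMap x'))
  refine ⟨e'.symm ≪≫ r ≪≫ e, ?_⟩
  have hsq : r.hom ≫ Y.fromSpecResidueField (π.base x') = Y'.fromSpecResidueField x' ≫ π :=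
    Scheme.Hom.SpecMap_residueFieldMap_fromSpecResidueField π x'
  simp only [Iso.trans_hom, Iso.symm_hom, Category.assoc]
  rw [he, hsq, ← Category.assoc]
  congr 1
  rw [Iso.inv_comp_eq]
  exact he'.symm

end Summit.ResolutionOfSingularities.ResolutionOfSingularities.Theorems.SigmaMaxModificationsCorridor3.Helpers

end
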